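import Literature.MathematicalPhysics.QuantumFieldTheory.Balaban1983to89.B15Prop1MinimiserFamilyFromRightInverse
import Literature.MathematicalPhysics.QuantumFieldTheory.Balaban1983to89.B15Prop1LocalChartAtBaseFieldTower
import Literature.MathematicalPhysics.QuantumFieldTheory.Balaban1983to89.B15Prop1BaseCriticalityFromMinimiserTower
import Literature.MathematicalPhysics.QuantumFieldTheory.Balaban1983to89.B15Prop1OntoFromRightInverseTower
import Literature.MathematicalPhysics.QuantumFieldTheory.Balaban1983to89.B15Prop1SliceNondegeneracyFromRealCoerciveTower

/-!
# `Balaban1983to89.B15Prop1MinimiserFamilyFromRightInverseTower` — [Balaban1985Variational] = «[15]», Thm 1 p. 279, (2),(6) p. 278, Sect. C (45),(47)–(48) p. 285, Sect. F p. 300, Sect. G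
# pp. 305–307, Prop. 9 (190) p. 309; [Balaban1989LargeFieldI] (1.74) p. 192, Prop. 1 p. 194; [Balaban1989LargeFieldII] (1.9) p. 358: THE LETTER (J0′) `hMin` FROM THE REDUCED PER-BASE-FIELD
# LETTER SET (velocity currency), UNDER THE PER-TOWER (0.4) GUARDS — the «TP» twin of `B15Prop1MinimiserFamilyFromRightInverse` (LOCATED-E1-HSB repair step (r3), link 9a∕9)

Honest framing: statement-level skeleton of published theorems with citation tags; proofs where landed; nothing here is a claim about the
Yang–Mills mass gap.  Cell `pub-ymgap`, HUMAN RULING D-0062 (Track A), seat `pub-ymgap-dag-n12-c` g24 (lane owner N12 = [B15], strategy s1; lane memo `N12-UNIFORMITY-SPEC.md` §6,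
plan g91 word pub-ymgap INBOX l.45435 «(r3) = ADDITIVE TP-twins»); count-neutral; N12 NOT discharged; finite 𝕋⁴ at fixed ε; nothing continuum ∕ OS ∕ mass-gap ∕ Clay.

WHAT CHANGES AGAINST THE TWIN (dag-n12-w1 g2's `B15Prop1MinimiserFamilyFromRightInverse`, untouched).  In the per-base-field letter set `hbase` the two GLOBAL (0.4) guards
`SmallBelow k (Q_k^{s*}(ext V_k))`, `SmallBelow k U₀` — false for data rough off `Z` (lane memo §6) — are REPLACED by the ENUMERATED per-tower guards at the constrained bonds of `𝔹`
(`∀ i, ∀ j′ < j_i, ∀ c′ ∈ bondsIn (j′+1) (blockIter j_i ⁻¹' {c_i₋, c_i₊}), Small (Ū^{j′} ·) c′` — INHABITED for the (2.12) minimiser by `Summits/…/BalabanUVNodesN12TowerGuardsOfClass` and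
for the datum from scale-`k` plaquette smallness, step (r2)), plus the standing range `hk : k ≤ m + K`.  ALL OTHER LETTERS ARE UNCHANGED — in particular the (45) right inverse `hH` is in
VELOCITY currency (intrinsic group-valued averages at the constrained bonds; no `fderiv` of a total extension is read — cf. the lane's note «LOCATED-E1-DITERL» on the `dIterL` editions,
which are not twinned).  Proofs VERBATIM over the `_of_guardOn` twins of `honto_of_rightInverse`, `hcrit_of_isMinimizer`, `exists_localChart_at_baseField`,
`hnondeg_slice_of_realSecondVariation_pos`; `hMin_of_localCharts` and the class openness are the tree's.

CONTENTS (theorems only; no `def`, no `instance`, no `sorry`).  ★★★ `hMin_of_rightInverseLetters_of_guardOn` (generic `P`, class `reg`) · ★★★ `hMin_atRecord_of_rightInverseLetters_of_guardOn`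
(NODE 00's `avOfRecord F 2 Kt` ∕ `regMSCoPOfRecord F 2 ν Kt kc Ω`; class openness a theorem) · ★★★ `hMin_atRecord_of_realCoerciveLetters_of_guardOn` ((β) in REAL second-variation currency on
the kernel `DΦ₀(0)⟨cplxVec p⟩ = 0`).
-/

noncomputable section

namespace Literature.MathematicalPhysics.QuantumFieldTheory.Balaban1983to89.B15Prop1MinimiserFamilyFromRightInverseTower

open Set Metric Filter
open scoped Topology ContDiff ComplexConjugate
open Literature.MathematicalPhysics.QuantumFieldTheory.Balaban1983to89.Node00 (SU coeField coeField_apply SmallBelow ConstrSet constrCard constrEnum)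
open B15AveragingHolomorphic (iterMh)
open B15ComplexifiedDatumFamily (conjVec datumC datumC_real)
open B15SU2ChartHolomorphic (genE expMulC logCoordC)
open B15Prop1MinimiserFamilyPatching (hMin_of_localCharts)
open B15Prop1CriticalChartFromIFT (datumC_coeField_zero)
open B15Prop1LocalChartAtBaseFieldTower (exists_localChart_at_baseField_of_guardOn)
open B15Prop1ClassOpenAtRecord (eventually_coeField_of_eventually)
open B15Prop1BaseCriticalityFromMinimiserTower (hcrit_of_isMinimizer_of_guardOn)
open B15Prop1OntoFromRightInverseTower (honto_of_rightInverse_of_guardOn)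
open B15Prop1SliceNondegeneracyFromRealCoerciveTower (hnondeg_slice_of_realSecondVariation_pos_of_guardOn)
open Literature.MathematicalPhysics.QuantumFieldTheory.BalabanImbrieJaffe1984to88.BIJ85Eq453GaugeField (qsstarGIter0)
open B15Prop1AnalyticExtClause (cplxVec)
open B15Prop1ChartCalculusSU2 (E3)
open B15Prop1ChartSU2 (su2Chart)
open B15ShellGauge193 (shellGauge)
open B15Extension193 (extend)
open B16Sect1Backgrounds (expMul)
open ExpMeanLog (expMeanLogSU)
open BlockAveraging (blockAvg)
open T4CubeChartGnomonic (SU2)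
open T4Continuum B15DeterminingSets GaugeField
open scoped Matrix.Norms.L2Operator

variable {P : Params} {k : ℕ}

/-- ★★★ **THE LETTER (J0′) `hMin` FROM THE REDUCED PER-BASE-FIELD LETTER SET** (see the module docstring).  Per `V_k ∈ K`, `hbase` packages: a MINIMAL configuration `U₀` of the base
datum's (2.12) problem over `reg`, OPEN at `U₀`; the two guards; a conjugation-stable slice `S`; the action `a` and constraint coordinates `Φ₀` on `S` (pointwise, as in
`B15Prop1LocalChartAtBaseField`); and the DISPLAYED letters `hH` (real right inverse of the linearised averaging from `S`, velocity currency), `hnondeg` ((β); the multiplier is the one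
minimality provides, so the statement quantifies over all `ℓ₀` with `Da(0) = ℓ₀ ∘ DΦ₀(0)`), `hcritT`; and `hT1u`. [cite: Balaban1985Variational, Thm 1 p.279, Sect. C (45),(47)–(48) p.285, Sect. F p.300, Sect. G pp.305–307, Prop. 9 (190) p.309; Balaban1989LargeFieldI, (1.74) p.192, Prop. 1 p.194 (last clause); Balaban1989LargeFieldII, (1.9) p.359; Balaban1988Convergent, (2.10)–(2.14) pp.256–257] -/
theorem hMin_of_rightInverseLetters_of_guardOn (Λ : Set (Site P k)) (lo hi : Fin P.d → ℤ)
    (reg : Set (GaugeField P 0 SU2)) (𝔹 : DetSet P) (h𝔹 : ∀ j, k < j → 𝔹 j = ∅) (hk : k ≤ P.m + P.K)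
    (ext : GaugeField P k SU2 → GaugeField P k SU2) (hext : ∀ W, ext W = extend Λ (shellGauge W lo hi) W)
    {K : Set (GaugeField P k SU2)} (hK : IsCompact K) {𝓐₀ : ℝ} (h𝓐₀ : 1 < 𝓐₀)
    (Crit : GaugeField P 0 SU2 → GaugeField P 0 SU2 → Prop)
    (hbase : ∀ Vk ∈ K, ∃ (U₀ : GaugeField P 0 SU2) (S : Submodule ℂ (VecField P 0 (EuclideanSpace ℂ (Fin 3))))
        (a : S → ℂ) (Φ₀ : S → Fin (constrCard 𝔹 k) → EuclideanSpace ℂ (Fin 3)),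
      -- the base configuration is a MINIMISER of the base datum's (2.12) problem over `reg`, and `reg` is open at it ([15] Thm 1 existence; class (6) open)
      IsMinimizer (fun j => blockAvg (P := P) (j := j) expMeanLogSU) reg 𝔹
        (avgFamily (fun j => blockAvg (P := P) (j := j) expMeanLogSU) (qsstarGIter0 k (ext Vk))) U₀ ∧
      (∀ᶠ U in 𝓝 U₀, U ∈ reg) ∧
      (∀ i : Fin (constrCard 𝔹 k), ∀ j', j' < (((constrEnum 𝔹 k).symm i).1 : ℕ) → ∀ c' : PBond P (j' + 1),
        c' ∈ B10Eq42TorusConstraint.bondsIn (j' + 1) (B14.Eq22Determines.blockIter (((constrEnum 𝔹 k).symm i).1 : ℕ) ⁻¹'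
          ({((constrEnum 𝔹 k).symm i).2.1.src, ((constrEnum 𝔹 k).symm i).2.1.tgt} : Set (Site P ((constrEnum 𝔹 k).symm i).1))) →
          BlockAveraging.Small expMeanLogSU (Averaging.iter (fun j => blockAvg (P := P) (j := j) expMeanLogSU) j' (qsstarGIter0 k (ext Vk))) c') ∧
      (∀ i : Fin (constrCard 𝔹 k), ∀ j', j' < (((constrEnum 𝔹 k).symm i).1 : ℕ) → ∀ c' : PBond P (j' + 1),
        c' ∈ B10Eq42TorusConstraint.bondsIn (j' + 1) (B14.Eq22Determines.blockIter (((constrEnum 𝔹 k).symm i).1 : ℕ) ⁻¹'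
          ({((constrEnum 𝔹 k).symm i).2.1.src, ((constrEnum 𝔹 k).symm i).2.1.tgt} : Set (Site P ((constrEnum 𝔹 k).symm i).1))) →
          BlockAveraging.Small expMeanLogSU (Averaging.iter (fun j => blockAvg (P := P) (j := j) expMeanLogSU) j' U₀) c') ∧
      (∀ X ∈ S, conjVec X ∈ S) ∧
      (∀ X : S, a X = ∑ p : Plaq P 0, (1 - (expMulC (X : VecField P 0 (EuclideanSpace ℂ (Fin 3))) (coeField U₀) ⟨p.src, p.μ⟩ *
        expMulC (X : VecField P 0 (EuclideanSpace ℂ (Fin 3))) (coeField U₀) ⟨p.src.shift p.μ, p.ν⟩ *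
        Matrix.adjugate (expMulC (X : VecField P 0 (EuclideanSpace ℂ (Fin 3))) (coeField U₀) ⟨p.src.shift p.ν, p.μ⟩) *
        Matrix.adjugate (expMulC (X : VecField P 0 (EuclideanSpace ℂ (Fin 3))) (coeField U₀) ⟨p.src, p.ν⟩)).trace / 2)) ∧
      (∀ (X : S) i, Φ₀ X i = logCoordC (star ((avgFamily (fun j => blockAvg (P := P) (j := j) expMeanLogSU) (qsstarGIter0 k (ext Vk))
        ((constrEnum 𝔹 k).symm i).1 ((constrEnum 𝔹 k).symm i).2.1 : SU2) : Matrix (Fin 2) (Fin 2) ℂ) *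
        iterMh ((constrEnum 𝔹 k).symm i).1 (expMulC (X : VecField P 0 (EuclideanSpace ℂ (Fin 3))) (coeField U₀)) ((constrEnum 𝔹 k).symm i).2.1)) ∧
      -- DISPLAYED ([15] (45)): a REAL right inverse of the linearised multi-scale averaging from the slice, velocity currency
      (∀ τ : Fin (constrCard 𝔹 k) → EuclideanSpace ℝ (Fin 3), ∃ p : VecField P 0 E3, cplxVec p ∈ S ∧
        ∀ i : Fin (constrCard 𝔹 k), HasDerivAt (fun s : ℝ => ((avgFamily (fun j => blockAvg (P := P) (j := j) expMeanLogSU) (expMul su2Chart (s • p) U₀)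
          ((constrEnum 𝔹 k).symm i).1 ((constrEnum 𝔹 k).symm i).2.1 : SU2) : Matrix (Fin 2) (Fin 2) ℂ))
          (((avgFamily (fun j => blockAvg (P := P) (j := j) expMeanLogSU) (qsstarGIter0 k (ext Vk)) ((constrEnum 𝔹 k).symm i).1
            ((constrEnum 𝔹 k).symm i).2.1 : SU2) : Matrix (Fin 2) (Fin 2) ℂ) * ∑ b : Fin 3, ((τ i b : ℝ) : ℂ) • genE b) 0) ∧
      -- DISPLAYED ((β)): the Lagrange Hessian is nondegenerate on `ker DΦ₀(0)`, for every multiplier of the base state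
      (∀ ℓ₀ : (Fin (constrCard 𝔹 k) → EuclideanSpace ℂ (Fin 3)) →L[ℂ] ℂ, fderiv ℂ a 0 = ℓ₀.comp (fderiv ℂ Φ₀ 0) →
        ∀ s : S, fderiv ℂ Φ₀ 0 s = 0 →
          (∀ t : S, fderiv ℂ Φ₀ 0 t = 0 → fderiv ℂ (fderiv ℂ a) 0 s t - ℓ₀ (fderiv ℂ (fderiv ℂ Φ₀) 0 s t) = 0) → s = 0) ∧
      -- DISPLAYED ([15] Sect. F): criticality transfer
      (∀ᶠ w in 𝓝 ((0 : S), coeField (qsstarGIter0 k (ext Vk))), ∀ (U' Q' : GaugeField P 0 SU2) (μ : (Fin (constrCard 𝔹 k) → EuclideanSpace ℂ (Fin 3)) →L[ℂ] ℂ),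
        expMulC (w.1 : VecField P 0 (EuclideanSpace ℂ (Fin 3))) (coeField U₀) = coeField U' → coeField Q' = w.2 →
          AgreeOn 𝔹 (avgFamily (fun j => blockAvg (P := P) (j := j) expMeanLogSU) U') (avgFamily (fun j => blockAvg (P := P) (j := j) expMeanLogSU) Q') →
          fderiv ℂ a w.1 = μ.comp (fderiv ℂ Φ₀ w.1) → Crit Q' U'))
    -- [15] Thm 1's uniqueness clause near each base datum (DISPLAYED)
    (hT1u : ∀ Vk ∈ K, ∀ᶠ Q in 𝓝 (coeField (qsstarGIter0 k (ext Vk))), ∀ U' Q' : GaugeField P 0 SU2, coeField Q' = Q →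
      U' ∈ reg → AgreeOn 𝔹 (avgFamily (fun j => blockAvg (P := P) (j := j) expMeanLogSU) U') (avgFamily (fun j => blockAvg (P := P) (j := j) expMeanLogSU) Q') →
        Crit Q' U' → IsMinimizer (fun j => blockAvg (P := P) (j := j) expMeanLogSU) reg 𝔹 (avgFamily (fun j => blockAvg (P := P) (j := j) expMeanLogSU) Q') U') :
    ∃ R : ℝ, 0 < R ∧ ∀ Vk ∈ K,
      ∃ Ũ : VecField P k (EuclideanSpace ℂ (Fin 3)) × VecField P k (EuclideanSpace ℂ (Fin 3)) → PBond P 0 → Matrix (Fin 2) (Fin 2) ℂ,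
        (∀ b i j, DifferentiableOn ℂ (fun z => Ũ z b i j) (ball 0 R)) ∧
        (∀ z ∈ ball (0 : VecField P k (EuclideanSpace ℂ (Fin 3)) × VecField P k (EuclideanSpace ℂ (Fin 3))) R, ∀ b i j, ‖Ũ z b i j‖ ≤ 𝓐₀) ∧
        ∀ p B' : VecField P k E3, ‖p‖ < R → ‖B'‖ < R → ∃ U' : GaugeField P 0 SU2,
          (∀ b, Ũ (cplxVec p, cplxVec B') b = ((U' b : SU2) : Matrix (Fin 2) (Fin 2) ℂ)) ∧
            IsMinimizer (fun j => blockAvg (P := P) (j := j) expMeanLogSU) reg 𝔹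
              (avgFamily (fun j => blockAvg (P := P) (j := j) expMeanLogSU) (qsstarGIter0 k (expMul su2Chart B' (ext (expMul su2Chart p Vk))))) U' := by
  refine hMin_of_localCharts Λ lo hi (fun j => blockAvg (P := P) (j := j) expMeanLogSU) reg 𝔹 ext hK fun Vk hVk => ?_
  obtain ⟨U₀, S, a, Φ₀, hmin, hregopen, hgQ, hgU, hS, ha, hΦ₀, hH, hnondeg, hcritT⟩ := hbase Vk hVk
  have hU₀ : AgreeOn 𝔹 (avgFamily (fun j => blockAvg (P := P) (j := j) expMeanLogSU) U₀)
      (avgFamily (fun j => blockAvg (P := P) (j := j) expMeanLogSU) (qsstarGIter0 k (ext Vk))) := hmin.2.1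
  -- the datum coordinates, pointwise
  set κ : (PBond P 0 → Matrix (Fin 2) (Fin 2) ℂ) → Fin (constrCard 𝔹 k) → EuclideanSpace ℂ (Fin 3) := fun Q i =>
    logCoordC (star ((avgFamily (fun j => blockAvg (P := P) (j := j) expMeanLogSU) (qsstarGIter0 k (ext Vk)) ((constrEnum 𝔹 k).symm i).1
      ((constrEnum 𝔹 k).symm i).2.1 : SU2) : Matrix (Fin 2) (Fin 2) ℂ) * iterMh ((constrEnum 𝔹 k).symm i).1 Q ((constrEnum 𝔹 k).symm i).2.1) with hκdef
  have hκ : ∀ Q i, κ Q i = logCoordC (star ((avgFamily (fun j => blockAvg (P := P) (j := j) expMeanLogSU) (qsstarGIter0 k (ext Vk)) ((constrEnum 𝔹 k).symm i).1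
      ((constrEnum 𝔹 k).symm i).2.1 : SU2) : Matrix (Fin 2) (Fin 2) ℂ) * iterMh ((constrEnum 𝔹 k).symm i).1 Q ((constrEnum 𝔹 k).symm i).2.1) := fun Q i => rfl
  have hΦ₀κ : ∀ X : S, Φ₀ X = κ (expMulC (X : VecField P 0 (EuclideanSpace ℂ (Fin 3))) (coeField U₀)) := fun X => funext fun i => by rw [hΦ₀, hκ]
  -- `honto` from the right inverse, `hcrit` from minimality, `hclass` from openness
  have honto : Function.Surjective (fderiv ℂ Φ₀ 0) :=
    honto_of_rightInverse_of_guardOn 𝔹 k hk _ κ hκ hgU hU₀ S Φ₀ hΦ₀κ hH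
  obtain ⟨ℓ₀, hcrit⟩ := hcrit_of_isMinimizer_of_guardOn 𝔹 k h𝔹 hk reg hgQ hgU hmin hregopen S hS a ha Φ₀ hΦ₀ honto
  have hclass : ∀ᶠ Q in 𝓝 (coeField U₀), ∀ U' : GaugeField P 0 SU2, coeField U' = Q → U' ∈ reg := eventually_coeField_of_eventually hregopen
  -- the local chart at this base field, then the bookkeeping of `hMin_of_localCharts`
  obtain ⟨O, hO, hmem, Γ, hΓd, hΓb, hΓr⟩ := exists_localChart_at_baseField_of_guardOn 𝔹 k h𝔹 reg hk hgQ hgU hU₀ S hS a ha Φ₀ hΦ₀ hcrit honto (hnondeg ℓ₀ hcrit)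
    Crit hclass hcritT (hT1u Vk hVk) h𝓐₀
  refine ⟨O, hO, by rwa [datumC_coeField_zero Λ lo hi ext hext], Γ, hΓd, hΓb, fun p B' Vk' hQ' => ?_⟩
  have hreal : datumC Λ lo hi (coeField Vk') (cplxVec p) (cplxVec B') =
      coeField (qsstarGIter0 k (expMul su2Chart B' (ext (expMul su2Chart p Vk')))) := by
    rw [datumC_real, ← hext]
  rw [hreal] at hQ' ⊢
  exact hΓr _ hQ'

/-! ## §2  At NODE 00's class of record: the openness of the class is a theorem (`B15Prop1ClassOpenAtRecord`) -/

section Record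

variable {F : T4Family} {k : ℕ}

/-- ★★★ **THE LETTER (J0′) `hMin` AT NODE 00's OBJECTS FROM THE REDUCED LETTER SET** — `hMin_of_rightInverseLetters` at the averaging of record `Node00.avOfRecord F 2 Kt` and print's class
(6) of record `Node00.regMSCoPOfRecord F 2 ν Kt kc Ω` (any `kc`, `Ω`), where the openness of the class at the minimiser is a THEOREM (`eventually_mem_regMSCoPOfRecordAt`, n07-e's
curve-openness of (1.7)∕(1.9)).  Per base field the consumer supplies: a MINIMISER `U₀` ([15] Thm 1 existence), the guards, a conjugation-stable slice `S` with the pointwise `a`, `Φ₀`,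
the real right inverse `hH` ([15] (45)), (β) `hnondeg`, the criticality transfer `hcritT`; and `hT1u`. [cite: Balaban1985Variational, Thm 1 p.279, (2),(6) p.278, Sect. C (45) p.285, Sect. F p.300, Prop. 9 (190) p.309; Balaban1989LargeFieldI, (1.74) p.192, Prop. 1 p.194; Balaban1988Convergent, (2.12) p.256] -/
theorem hMin_atRecord_of_rightInverseLetters_of_guardOn (ν : Node00.Stage7Numerics) (Kt kc : ℕ) (Ω : ℕ → Set (Site (F.P Kt) 0))
    (Λ : Set (Site (F.P Kt) k)) (lo hi : Fin (F.P Kt).d → ℤ) (𝔹 : DetSet (F.P Kt)) (h𝔹 : ∀ j, k < j → 𝔹 j = ∅) (hk : k ≤ (F.P Kt).m + (F.P Kt).K)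
    (ext : GaugeField (F.P Kt) k SU2 → GaugeField (F.P Kt) k SU2) (hext : ∀ W, ext W = extend Λ (shellGauge W lo hi) W)
    {K : Set (GaugeField (F.P Kt) k SU2)} (hK : IsCompact K) {𝓐₀ : ℝ} (h𝓐₀ : 1 < 𝓐₀)
    (Crit : GaugeField (F.P Kt) 0 SU2 → GaugeField (F.P Kt) 0 SU2 → Prop)
    (hbase : ∀ Vk ∈ K, ∃ (U₀ : GaugeField (F.P Kt) 0 SU2) (S : Submodule ℂ (VecField (F.P Kt) 0 (EuclideanSpace ℂ (Fin 3))))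
        (a : S → ℂ) (Φ₀ : S → Fin (constrCard 𝔹 k) → EuclideanSpace ℂ (Fin 3)),
      IsMinimizer (Node00.avOfRecord F 2 Kt) (Node00.regMSCoPOfRecord F 2 ν Kt kc Ω) 𝔹
        (avgFamily (Node00.avOfRecord F 2 Kt) (qsstarGIter0 k (ext Vk))) U₀ ∧
      (∀ i : Fin (constrCard 𝔹 k), ∀ j', j' < (((constrEnum 𝔹 k).symm i).1 : ℕ) → ∀ c' : PBond (F.P Kt) (j' + 1),
        c' ∈ B10Eq42TorusConstraint.bondsIn (j' + 1) (B14.Eq22Determines.blockIter (((constrEnum 𝔹 k).symm i).1 : ℕ) ⁻¹'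
          ({((constrEnum 𝔹 k).symm i).2.1.src, ((constrEnum 𝔹 k).symm i).2.1.tgt} : Set (Site (F.P Kt) ((constrEnum 𝔹 k).symm i).1))) →
          BlockAveraging.Small expMeanLogSU (Averaging.iter (Node00.avOfRecord F 2 Kt) j' (qsstarGIter0 k (ext Vk))) c') ∧
      (∀ i : Fin (constrCard 𝔹 k), ∀ j', j' < (((constrEnum 𝔹 k).symm i).1 : ℕ) → ∀ c' : PBond (F.P Kt) (j' + 1),
        c' ∈ B10Eq42TorusConstraint.bondsIn (j' + 1) (B14.Eq22Determines.blockIter (((constrEnum 𝔹 k).symm i).1 : ℕ) ⁻¹'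
          ({((constrEnum 𝔹 k).symm i).2.1.src, ((constrEnum 𝔹 k).symm i).2.1.tgt} : Set (Site (F.P Kt) ((constrEnum 𝔹 k).symm i).1))) →
          BlockAveraging.Small expMeanLogSU (Averaging.iter (Node00.avOfRecord F 2 Kt) j' U₀) c') ∧
      (∀ X ∈ S, conjVec X ∈ S) ∧
      (∀ X : S, a X = ∑ p : Plaq (F.P Kt) 0, (1 - (expMulC (X : VecField (F.P Kt) 0 (EuclideanSpace ℂ (Fin 3))) (coeField U₀) ⟨p.src, p.μ⟩ *
        expMulC (X : VecField (F.P Kt) 0 (EuclideanSpace ℂ (Fin 3))) (coeField U₀) ⟨p.src.shift p.μ, p.ν⟩ *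
        Matrix.adjugate (expMulC (X : VecField (F.P Kt) 0 (EuclideanSpace ℂ (Fin 3))) (coeField U₀) ⟨p.src.shift p.ν, p.μ⟩) *
        Matrix.adjugate (expMulC (X : VecField (F.P Kt) 0 (EuclideanSpace ℂ (Fin 3))) (coeField U₀) ⟨p.src, p.ν⟩)).trace / 2)) ∧
      (∀ (X : S) i, Φ₀ X i = logCoordC (star ((avgFamily (Node00.avOfRecord F 2 Kt) (qsstarGIter0 k (ext Vk))
        ((constrEnum 𝔹 k).symm i).1 ((constrEnum 𝔹 k).symm i).2.1 : SU2) : Matrix (Fin 2) (Fin 2) ℂ) *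
        iterMh ((constrEnum 𝔹 k).symm i).1 (expMulC (X : VecField (F.P Kt) 0 (EuclideanSpace ℂ (Fin 3))) (coeField U₀)) ((constrEnum 𝔹 k).symm i).2.1)) ∧
      (∀ τ : Fin (constrCard 𝔹 k) → EuclideanSpace ℝ (Fin 3), ∃ p : VecField (F.P Kt) 0 E3, cplxVec p ∈ S ∧
        ∀ i : Fin (constrCard 𝔹 k), HasDerivAt (fun s : ℝ => ((avgFamily (Node00.avOfRecord F 2 Kt) (expMul su2Chart (s • p) U₀)
          ((constrEnum 𝔹 k).symm i).1 ((constrEnum 𝔹 k).symm i).2.1 : SU2) : Matrix (Fin 2) (Fin 2) ℂ))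
          (((avgFamily (Node00.avOfRecord F 2 Kt) (qsstarGIter0 k (ext Vk)) ((constrEnum 𝔹 k).symm i).1
            ((constrEnum 𝔹 k).symm i).2.1 : SU2) : Matrix (Fin 2) (Fin 2) ℂ) * ∑ b : Fin 3, ((τ i b : ℝ) : ℂ) • genE b) 0) ∧
      (∀ ℓ₀ : (Fin (constrCard 𝔹 k) → EuclideanSpace ℂ (Fin 3)) →L[ℂ] ℂ, fderiv ℂ a 0 = ℓ₀.comp (fderiv ℂ Φ₀ 0) →
        ∀ s : S, fderiv ℂ Φ₀ 0 s = 0 →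
          (∀ t : S, fderiv ℂ Φ₀ 0 t = 0 → fderiv ℂ (fderiv ℂ a) 0 s t - ℓ₀ (fderiv ℂ (fderiv ℂ Φ₀) 0 s t) = 0) → s = 0) ∧
      (∀ᶠ w in 𝓝 ((0 : S), coeField (qsstarGIter0 k (ext Vk))), ∀ (U' Q' : GaugeField (F.P Kt) 0 SU2) (μ : (Fin (constrCard 𝔹 k) → EuclideanSpace ℂ (Fin 3)) →L[ℂ] ℂ),
        expMulC (w.1 : VecField (F.P Kt) 0 (EuclideanSpace ℂ (Fin 3))) (coeField U₀) = coeField U' → coeField Q' = w.2 →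
          AgreeOn 𝔹 (avgFamily (Node00.avOfRecord F 2 Kt) U') (avgFamily (Node00.avOfRecord F 2 Kt) Q') →
          fderiv ℂ a w.1 = μ.comp (fderiv ℂ Φ₀ w.1) → Crit Q' U'))
    (hT1u : ∀ Vk ∈ K, ∀ᶠ Q in 𝓝 (coeField (qsstarGIter0 k (ext Vk))), ∀ U' Q' : GaugeField (F.P Kt) 0 SU2, coeField Q' = Q →
      U' ∈ Node00.regMSCoPOfRecord F 2 ν Kt kc Ω → AgreeOn 𝔹 (avgFamily (Node00.avOfRecord F 2 Kt) U') (avgFamily (Node00.avOfRecord F 2 Kt) Q') →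
        Crit Q' U' → IsMinimizer (Node00.avOfRecord F 2 Kt) (Node00.regMSCoPOfRecord F 2 ν Kt kc Ω) 𝔹 (avgFamily (Node00.avOfRecord F 2 Kt) Q') U') :
    ∃ R : ℝ, 0 < R ∧ ∀ Vk ∈ K,
      ∃ Ũ : VecField (F.P Kt) k (EuclideanSpace ℂ (Fin 3)) × VecField (F.P Kt) k (EuclideanSpace ℂ (Fin 3)) → PBond (F.P Kt) 0 → Matrix (Fin 2) (Fin 2) ℂ,
        (∀ b i j, DifferentiableOn ℂ (fun z => Ũ z b i j) (ball 0 R)) ∧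
        (∀ z ∈ ball (0 : VecField (F.P Kt) k (EuclideanSpace ℂ (Fin 3)) × VecField (F.P Kt) k (EuclideanSpace ℂ (Fin 3))) R, ∀ b i j, ‖Ũ z b i j‖ ≤ 𝓐₀) ∧
        ∀ p B' : VecField (F.P Kt) k E3, ‖p‖ < R → ‖B'‖ < R → ∃ U' : GaugeField (F.P Kt) 0 SU2,
          (∀ b, Ũ (cplxVec p, cplxVec B') b = ((U' b : SU2) : Matrix (Fin 2) (Fin 2) ℂ)) ∧
            IsMinimizer (Node00.avOfRecord F 2 Kt) (Node00.regMSCoPOfRecord F 2 ν Kt kc Ω) 𝔹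
              (avgFamily (Node00.avOfRecord F 2 Kt) (qsstarGIter0 k (expMul su2Chart B' (ext (expMul su2Chart p Vk))))) U' :=
  hMin_of_rightInverseLetters_of_guardOn Λ lo hi (Node00.regMSCoPOfRecord F 2 ν Kt kc Ω) 𝔹 h𝔹 hk ext hext hK h𝓐₀ Crit
    (fun Vk hVk => by
      obtain ⟨U₀, S, a, Φ₀, hmin, hgQ, hgU, hS, ha, hΦ₀, hH, hnondeg, hcritT⟩ := hbase Vk hVk
      exact ⟨U₀, S, a, Φ₀, hmin, B15Prop1ClassOpenAtRecord.eventually_mem_regMSCoPOfRecordAt F 2 ν Kt kc _ Ω hmin.1, hgQ, hgU, hS, ha, hΦ₀, hH, hnondeg, hcritT⟩)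
    hT1u

/-- ★★★ **THE LETTER (J0′) `hMin` AT NODE 00's OBJECTS WITH (β) IN REAL SECOND-VARIATION CURRENCY** — `hMin_atRecord_of_rightInverseLetters` with the complex nondegeneracy letter
replaced, per base field and per multiplier `ℓ₀` of the base state (`Da(0) = ℓ₀ ∘ DΦ₀(0)`), by POSITIVITY OF THE REAL SECOND VARIATION along every non-zero real slice field `p`
(`cplxVec p ∈ S`) in the kernel of the linearised constraint:
`0 < d²∕dt² [ wilsonAction4 (expMul su2Chart (t • p) U₀) − Re ℓ₀ (Φ₀ ((t:ℂ) • ⟨cplxVec p, _⟩)) ] |₀` — the currency of the sibling lanes' (β) estimates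
(`B16Ineq19NearFlatSlice.h17_nearFlat`, `B16Ineq17NearFlatOneSided.lagrangeHessian_ge_flatMin_sub`); the reduction is `B15Prop1SliceNondegeneracyFromRealCoercive` over n12-w2's
`LagrangeHessianRealCoercive.hnondeg_of_re_pos`.  Remaining DISPLAYED per base field: the MINIMISER `U₀` ([15] Thm 1 existence), the guards, the slice `S` with the real right inverse
`hH` ([15] (45)), this real (β) positivity, the criticality transfer `hcritT`; and `hT1u`. [cite: Balaban1989LargeFieldII, (1.9) p.358, (1.12) p.359, p.359; Balaban1985Variational, Thm 1 p.279, Sect. C (45) p.285, Sect. F p.300, Sect. G pp.305–307, Prop. 9 (190) p.309; Balaban1989LargeFieldI, (1.74) p.192, Prop. 1 p.194; Balaban1988Convergent, (2.12) p.256] -/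
theorem hMin_atRecord_of_realCoerciveLetters_of_guardOn (ν : Node00.Stage7Numerics) (Kt kc : ℕ) (Ω : ℕ → Set (Site (F.P Kt) 0))
    (Λ : Set (Site (F.P Kt) k)) (lo hi : Fin (F.P Kt).d → ℤ) (𝔹 : DetSet (F.P Kt)) (h𝔹 : ∀ j, k < j → 𝔹 j = ∅) (hk : k ≤ (F.P Kt).m + (F.P Kt).K)
    (ext : GaugeField (F.P Kt) k SU2 → GaugeField (F.P Kt) k SU2) (hext : ∀ W, ext W = extend Λ (shellGauge W lo hi) W)
    {K : Set (GaugeField (F.P Kt) k SU2)} (hK : IsCompact K) {𝓐₀ : ℝ} (h𝓐₀ : 1 < 𝓐₀)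
    (Crit : GaugeField (F.P Kt) 0 SU2 → GaugeField (F.P Kt) 0 SU2 → Prop)
    (hbase : ∀ Vk ∈ K, ∃ (U₀ : GaugeField (F.P Kt) 0 SU2) (S : Submodule ℂ (VecField (F.P Kt) 0 (EuclideanSpace ℂ (Fin 3))))
        (a : S → ℂ) (Φ₀ : S → Fin (constrCard 𝔹 k) → EuclideanSpace ℂ (Fin 3)),
      IsMinimizer (Node00.avOfRecord F 2 Kt) (Node00.regMSCoPOfRecord F 2 ν Kt kc Ω) 𝔹
        (avgFamily (Node00.avOfRecord F 2 Kt) (qsstarGIter0 k (ext Vk))) U₀ ∧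
      (∀ i : Fin (constrCard 𝔹 k), ∀ j', j' < (((constrEnum 𝔹 k).symm i).1 : ℕ) → ∀ c' : PBond (F.P Kt) (j' + 1),
        c' ∈ B10Eq42TorusConstraint.bondsIn (j' + 1) (B14.Eq22Determines.blockIter (((constrEnum 𝔹 k).symm i).1 : ℕ) ⁻¹'
          ({((constrEnum 𝔹 k).symm i).2.1.src, ((constrEnum 𝔹 k).symm i).2.1.tgt} : Set (Site (F.P Kt) ((constrEnum 𝔹 k).symm i).1))) →
          BlockAveraging.Small expMeanLogSU (Averaging.iter (Node00.avOfRecord F 2 Kt) j' (qsstarGIter0 k (ext Vk))) c') ∧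
      (∀ i : Fin (constrCard 𝔹 k), ∀ j', j' < (((constrEnum 𝔹 k).symm i).1 : ℕ) → ∀ c' : PBond (F.P Kt) (j' + 1),
        c' ∈ B10Eq42TorusConstraint.bondsIn (j' + 1) (B14.Eq22Determines.blockIter (((constrEnum 𝔹 k).symm i).1 : ℕ) ⁻¹'
          ({((constrEnum 𝔹 k).symm i).2.1.src, ((constrEnum 𝔹 k).symm i).2.1.tgt} : Set (Site (F.P Kt) ((constrEnum 𝔹 k).symm i).1))) →
          BlockAveraging.Small expMeanLogSU (Averaging.iter (Node00.avOfRecord F 2 Kt) j' U₀) c') ∧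
      (∀ X ∈ S, conjVec X ∈ S) ∧
      (∀ X : S, a X = ∑ p : Plaq (F.P Kt) 0, (1 - (expMulC (X : VecField (F.P Kt) 0 (EuclideanSpace ℂ (Fin 3))) (coeField U₀) ⟨p.src, p.μ⟩ *
        expMulC (X : VecField (F.P Kt) 0 (EuclideanSpace ℂ (Fin 3))) (coeField U₀) ⟨p.src.shift p.μ, p.ν⟩ *
        Matrix.adjugate (expMulC (X : VecField (F.P Kt) 0 (EuclideanSpace ℂ (Fin 3))) (coeField U₀) ⟨p.src.shift p.ν, p.μ⟩) *
        Matrix.adjugate (expMulC (X : VecField (F.P Kt) 0 (EuclideanSpace ℂ (Fin 3))) (coeField U₀) ⟨p.src, p.ν⟩)).trace / 2)) ∧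
      (∀ (X : S) i, Φ₀ X i = logCoordC (star ((avgFamily (Node00.avOfRecord F 2 Kt) (qsstarGIter0 k (ext Vk))
        ((constrEnum 𝔹 k).symm i).1 ((constrEnum 𝔹 k).symm i).2.1 : SU2) : Matrix (Fin 2) (Fin 2) ℂ) *
        iterMh ((constrEnum 𝔹 k).symm i).1 (expMulC (X : VecField (F.P Kt) 0 (EuclideanSpace ℂ (Fin 3))) (coeField U₀)) ((constrEnum 𝔹 k).symm i).2.1)) ∧
      -- DISPLAYED ([15] (45)): a REAL right inverse of the linearised multi-scale averaging from the slice, velocity currency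
      (∀ τ : Fin (constrCard 𝔹 k) → EuclideanSpace ℝ (Fin 3), ∃ p : VecField (F.P Kt) 0 E3, cplxVec p ∈ S ∧
        ∀ i : Fin (constrCard 𝔹 k), HasDerivAt (fun s : ℝ => ((avgFamily (Node00.avOfRecord F 2 Kt) (expMul su2Chart (s • p) U₀)
          ((constrEnum 𝔹 k).symm i).1 ((constrEnum 𝔹 k).symm i).2.1 : SU2) : Matrix (Fin 2) (Fin 2) ℂ))
          (((avgFamily (Node00.avOfRecord F 2 Kt) (qsstarGIter0 k (ext Vk)) ((constrEnum 𝔹 k).symm i).1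
            ((constrEnum 𝔹 k).symm i).2.1 : SU2) : Matrix (Fin 2) (Fin 2) ℂ) * ∑ b : Fin 3, ((τ i b : ℝ) : ℂ) • genE b) 0) ∧
      -- DISPLAYED ((β), REAL currency): positivity of the real second variation of the Lagrangian along real slice fields in the kernel, for every multiplier of the base state
      (∀ ℓ₀ : (Fin (constrCard 𝔹 k) → EuclideanSpace ℂ (Fin 3)) →L[ℂ] ℂ, fderiv ℂ a 0 = ℓ₀.comp (fderiv ℂ Φ₀ 0) →
        ∀ (p : VecField (F.P Kt) 0 E3) (hp : cplxVec p ∈ S), p ≠ 0 → fderiv ℂ Φ₀ 0 ⟨cplxVec p, hp⟩ = 0 →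
          0 < deriv (deriv (fun t : ℝ => wilsonAction4 (expMul su2Chart (t • p) U₀) - (ℓ₀ (Φ₀ ((t : ℂ) • ⟨cplxVec p, hp⟩))).re)) 0) ∧
      -- DISPLAYED ([15] Sect. F): criticality transfer
      (∀ᶠ w in 𝓝 ((0 : S), coeField (qsstarGIter0 k (ext Vk))), ∀ (U' Q' : GaugeField (F.P Kt) 0 SU2) (μ : (Fin (constrCard 𝔹 k) → EuclideanSpace ℂ (Fin 3)) →L[ℂ] ℂ),
        expMulC (w.1 : VecField (F.P Kt) 0 (EuclideanSpace ℂ (Fin 3))) (coeField U₀) = coeField U' → coeField Q' = w.2 →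
          AgreeOn 𝔹 (avgFamily (Node00.avOfRecord F 2 Kt) U') (avgFamily (Node00.avOfRecord F 2 Kt) Q') →
          fderiv ℂ a w.1 = μ.comp (fderiv ℂ Φ₀ w.1) → Crit Q' U'))
    (hT1u : ∀ Vk ∈ K, ∀ᶠ Q in 𝓝 (coeField (qsstarGIter0 k (ext Vk))), ∀ U' Q' : GaugeField (F.P Kt) 0 SU2, coeField Q' = Q →
      U' ∈ Node00.regMSCoPOfRecord F 2 ν Kt kc Ω → AgreeOn 𝔹 (avgFamily (Node00.avOfRecord F 2 Kt) U') (avgFamily (Node00.avOfRecord F 2 Kt) Q') →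
        Crit Q' U' → IsMinimizer (Node00.avOfRecord F 2 Kt) (Node00.regMSCoPOfRecord F 2 ν Kt kc Ω) 𝔹 (avgFamily (Node00.avOfRecord F 2 Kt) Q') U') :
    ∃ R : ℝ, 0 < R ∧ ∀ Vk ∈ K,
      ∃ Ũ : VecField (F.P Kt) k (EuclideanSpace ℂ (Fin 3)) × VecField (F.P Kt) k (EuclideanSpace ℂ (Fin 3)) → PBond (F.P Kt) 0 → Matrix (Fin 2) (Fin 2) ℂ,
        (∀ b i j, DifferentiableOn ℂ (fun z => Ũ z b i j) (ball 0 R)) ∧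
        (∀ z ∈ ball (0 : VecField (F.P Kt) k (EuclideanSpace ℂ (Fin 3)) × VecField (F.P Kt) k (EuclideanSpace ℂ (Fin 3))) R, ∀ b i j, ‖Ũ z b i j‖ ≤ 𝓐₀) ∧
        ∀ p B' : VecField (F.P Kt) k E3, ‖p‖ < R → ‖B'‖ < R → ∃ U' : GaugeField (F.P Kt) 0 SU2,
          (∀ b, Ũ (cplxVec p, cplxVec B') b = ((U' b : SU2) : Matrix (Fin 2) (Fin 2) ℂ)) ∧
            IsMinimizer (Node00.avOfRecord F 2 Kt) (Node00.regMSCoPOfRecord F 2 ν Kt kc Ω) 𝔹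
              (avgFamily (Node00.avOfRecord F 2 Kt) (qsstarGIter0 k (expMul su2Chart B' (ext (expMul su2Chart p Vk))))) U' :=
  hMin_atRecord_of_rightInverseLetters_of_guardOn ν Kt kc Ω Λ lo hi 𝔹 h𝔹 hk ext hext hK h𝓐₀ Crit
    (fun Vk hVk => by
      obtain ⟨U₀, S, a, Φ₀, hmin, hgQ, hgU, hS, ha, hΦ₀, hH, hpos, hcritT⟩ := hbase Vk hVk
      exact ⟨U₀, S, a, Φ₀, hmin, hgQ, hgU, hS, ha, hΦ₀, hH, fun ℓ₀ hℓ₀ =>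
        hnondeg_slice_of_realSecondVariation_pos_of_guardOn 𝔹 k hk _ hgU hmin.2.1 S hS a ha Φ₀ hΦ₀ ℓ₀ (hpos ℓ₀ hℓ₀), hcritT⟩)
    hT1u

end Record

end Literature.MathematicalPhysics.QuantumFieldTheory.Balaban1983to89.B15Prop1MinimiserFamilyFromRightInverseTower

end
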